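import Summits.HodgeConjecture.CorCM.IrreducibleOddWeightsAdditivityHellyCMFields
import HarnessLib

/-!
# Pairwise `ρ`-separated slots: if complex conjugation on `K_i` can be realised by an automorphism fixing `K_j`
# (all `i ≠ j`), then `Hg(∏ A_i) = ∏ Hg(A_i)` — for arbitrary CM types

COR-CM (cell `pub-hodgecm2`, binder seat `b16` gen 59, count-neutral claim INDEX BOUND, file F10 — abstract `G`-set level and
CM fields; theorems only, no definition, no named fact, no `sorry`).  NEW as stated, hence under `Summits/`.  HONEST FRAMING:
unconditional finite-dimensional linear algebra over `ℚ` about the rank of families of CM types, read on Mumford–Tate groups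
of products of CM abelian varieties; `HC_CM` is neither used nor asserted.

THE MECHANISM behind every non-additivity (F7 `…AdditivityCriterion` §3, made explicit here): in a MINIMAL non-additive
family `T₀` there is ONE irreducible `V_k` which is a quotient of `U(Φ_i)` for EVERY member `i ∈ T₀`
(**`exists_forall_evalSpace_ne_bot_of_minimal_nonadditive`**).  On such a common quotient the kernel `N_j` of the action
on the slot `E_j` acts trivially, while `ρ` acts as `−1`.  Hence:

* **`finrank_antiSpan_sigmaType_eq_sum_of_pairwise_separated`** — if for all `i ≠ j` some `τ ∈ G` acts as `ρ` on `E_i` and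
  trivially on `E_j` («the slots are pairwise `ρ`-separated»), then EVERY family of CM types on these slots is additive:
  `dim U(Σ) = Σ_i dim U(Φ_i)`, `rank(Σ) − 1 = Σ_i (rank Φ_i − 1)` (`typeRank_sigmaType_add_card_eq_of_pairwise_separated`).
  This weakens the tree's `SlotwiseIndependent` (EVERY `g` realised on `E_i` by an element trivial on ALL other slots,
  `typeRank_sigmaType_add_card_eq`) to ONE element `ρ` and ONE other slot at a time.
* CM fields — **`cmFamilyRank_add_card_eq_of_pairwise_separated`**: if for all `i ≠ j` some automorphism of `ℂ` is
  complex conjugation on every embedding of `K_i` and the identity on every embedding of `K_j` (equivalently: the Galois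
  closures of `K_i` and `K_j` intersect in a TOTALLY REAL field), then `Hg(∏_i A_i) = ∏_i Hg(A_i)` for ARBITRARY CM types
  `Φ_i` (degenerate allowed) — and if moreover every `A_i` is nondegenerate the family is nondegenerate
  (`isNondegenerateFamily_iff_forall_of_pairwise_separated`; then HC with `B• = D•` on all products, tree).  Galois form over a common Galois
  field `L`: `cmFamilyRank_add_card_eq_of_pairwise_separated_gal`.

## References

* [MoonenZarhin1999LowDim] B. Moonen, Yu. Zarhin, *Hodge classes on abelian varieties of low dimension*, Math. Ann.
  315 (1999), §3 (3.1).
* [Gordon1999HodgeAVSurvey] B. B. Gordon, *A survey of the Hodge conjecture for abelian varieties*, §3 Theorem (Imai: distinct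
  imaginary quadratic fields) and 7.5–7.7.
* [Mai1989] L. Mai, *Lower bounds for the ranks of CM types*, J. Number Theory 32 (1989), §2 Prop. 1 (proof).
* [Shimura1998] G. Shimura, *Abelian Varieties with Complex Multiplication and Modular Functions*, §8.1, §18.2.
* [Serre1977] J.-P. Serre, *Linear Representations of Finite Groups*, GTM 42 (1977), §2.2 Prop. 4.
-/

set_option autoImplicit false

noncomputable section

open scoped BigOperators

open NumberField

universe u u' v w

namespace Summit.HodgeConjecture.CorCM

namespace IrrOdd

open Literature.NumberTheory.ComplexMultiplication

variable {G : Type w} [Group G]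

/-- The evaluation space `Ev[G, π, w] = {T w : T equivariant}` (local notation, no definition). -/
local notation3 (prettyPrint := false) "Ev[" G' ", " π ", " w "]" =>
  Submodule.span ℚ {v | ∃ T : (_ → ℚ) →ₗ[ℚ] _,
    (∀ (g : G') (f : _ → ℚ), T (fun x => f (g⁻¹ • x)) = π g (T f)) ∧ T w = v}

variable {I : Type u} {E : I → Type v} [∀ i, MulAction G (E i)] [Fintype I] [∀ i, Fintype (E i)]
  {K : Type u'} [Fintype K] {V : K → Type*} [∀ k, AddCommGroup (V k)] [∀ k, Module ℚ (V k)]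
  [∀ k, FiniteDimensional ℚ (V k)]

/-! ### §1 The common irreducible quotient of a minimal non-additive family -/

omit [Fintype I] in
/-- **A MINIMAL NON-ADDITIVE FAMILY HAS A COMMON IRREDUCIBLE QUOTIENT**: for covering irreducibles `(π_k, V_k)` and a
sub-family `T₀` which is non-additive while all its proper sub-families are additive, some `V_k` has `Ev_i(π_k) ≠ 0` for
EVERY `i ∈ T₀` — every `U(Φ_i)`, `i ∈ T₀`, maps equivariantly ONTO the same irreducible `V_k`.
[cite: Mai1989, §2 Prop. 1 (proof)] [cite: MoonenZarhin1999LowDim, §3 (3.1)] -/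
theorem exists_forall_evalSpace_ne_bot_of_minimal_nonadditive (Φ : ∀ i, Set (E i))
    (π : ∀ k, Representation ℚ G (V k)) (hirr : ∀ k, (π k).IsIrreducible)
    (hne : ∀ k l, k ≠ l → ∀ S : (π k).IntertwiningMap (π l), S = 0)
    (hcov : ∀ (i : I) (P : Submodule ℚ (E i → ℚ)), P ≤ antiSpan G (Φ i) → P ≠ ⊥ →
      (∀ (g : G) (a : E i → ℚ), a ∈ P → (fun s => a (g • s)) ∈ P) →
      ∃ k, ∃ T : (E i → ℚ) →ₗ[ℚ] V k,
        (∀ (g : G) (a : E i → ℚ), T (fun s => a (g⁻¹ • s)) = π k g (T a)) ∧ ∃ a ∈ P, T a ≠ 0)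
    (T₀ : Finset I)
    (hnot : Module.finrank ℚ (antiSpan G (sigmaType fun j : (T₀ : Set I) => Φ j)) ≠
      ∑ j : (T₀ : Set I), Module.finrank ℚ (antiSpan G (Φ j)))
    (hmin : ∀ T : Finset I, T ⊂ T₀ →
      Module.finrank ℚ (antiSpan G (sigmaType fun j : (T : Set I) => Φ j)) =
        ∑ j : (T : Set I), Module.finrank ℚ (antiSpan G (Φ j))) :
    ∃ k, ∀ i ∈ T₀, Ev[G, π k, antiVec (Φ i) (1 : G)] ≠ ⊥ := by
  classical
  have hFT : ∀ T : Finset I,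
      (Module.finrank ℚ (antiSpan G (sigmaType fun j : (T : Set I) => Φ j)) =
          ∑ j : (T : Set I), Module.finrank ℚ (antiSpan G (Φ j)) ↔
        ∀ k, Module.finrank ℚ (⨆ j : (T : Set I), Ev[G, π k, antiVec (Φ j) (1 : G)] : Submodule ℚ (V k)) =
          ∑ j : (T : Set I), Module.finrank ℚ Ev[G, π k, antiVec (Φ j) (1 : G)]) := fun T =>
    finrank_antiSpan_sigmaType_eq_sum_iff_forall (E := fun j : (T : Set I) => E j) (fun j => Φ j) π hirr hne
      fun j => hcov j
  set S : ∀ k, I → Submodule ℚ (V k) := fun k i => Ev[G, π k, antiVec (Φ i) (1 : G)] with hS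
  have hsupT : ∀ (k) (T : Finset I), (⨆ j : (T : Set I), S k j : Submodule ℚ (V k)) = T.sup (S k) := fun k T =>
    (finsetSup_eq_iSup_subtype (S k) T).symm
  have hsumT : ∀ (k) (T : Finset I), ∑ j : (T : Set I), Module.finrank ℚ (S k j) =
      ∑ i ∈ T, Module.finrank ℚ (S k i) := fun k T => Finset.sum_coe_sort T fun i => Module.finrank ℚ (S k i)
  have hind : ∀ T : Finset I, T ⊂ T₀ → ∀ k,
      Module.finrank ℚ (T.sup (S k) : Submodule ℚ (V k)) = ∑ i ∈ T, Module.finrank ℚ (S k i) := by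
    intro T hT k
    have h1 := (hFT T).1 (hmin T hT) k
    change Module.finrank ℚ (⨆ j : (T : Set I), S k j : Submodule ℚ (V k)) = ∑ j : (T : Set I), Module.finrank ℚ (S k j)
      at h1
    rwa [hsupT, hsumT] at h1
  obtain ⟨k, hk⟩ : ∃ k, Module.finrank ℚ (T₀.sup (S k) : Submodule ℚ (V k)) ≠ ∑ i ∈ T₀, Module.finrank ℚ (S k i) := by
    by_contra hall
    push Not at hall
    refine hnot ((hFT T₀).2 fun k => ?_)
    change Module.finrank ℚ (⨆ j : (T₀ : Set I), S k j : Submodule ℚ (V k)) = ∑ j : (T₀ : Set I), Module.finrank ℚ (S k j)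
    rw [hsupT, hsumT]
    exact hall k
  refine ⟨k, fun j hj h0 => hk ?_⟩
  have h' := hind _ (Finset.erase_ssubset hj) k
  have h0' : S k j = ⊥ := h0
  rw [← Finset.insert_erase hj, Finset.sup_insert, Finset.sum_insert (Finset.notMem_erase j T₀), h0', bot_sup_eq,
    finrank_bot, zero_add, h']

/-! ### §2 Pairwise `ρ`-separated slots are additive -/

omit [Fintype I] [∀ i, Fintype (E i)] in
/-- A non-zero evaluation space `Ev_i(π) ≠ 0` yields an equivariant `T : ℚ^{E_i} → V` with `T(u_1(Φ_i)) ≠ 0`, whose image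
of `U(Φ_i)` is all of the irreducible `V`. [cite: Serre1977, §2.2 Prop. 4] -/
theorem exists_equivariant_map_top_of_evalSpace_ne_bot {W : Type*} [AddCommGroup W] [Module ℚ W] (Φ : ∀ i, Set (E i))
    (σ : Representation ℚ G W) (hσ : σ.IsIrreducible) (i : I)
    (hEv : Ev[G, σ, antiVec (Φ i) (1 : G)] ≠ ⊥) :
    ∃ T : (E i → ℚ) →ₗ[ℚ] W, (∀ (g : G) (f : E i → ℚ), T (fun x => f (g⁻¹ • x)) = σ g (T f)) ∧
      T (antiVec (Φ i) (1 : G)) ≠ 0 ∧ (antiSpan G (Φ i)).map T = ⊤ := by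
  obtain ⟨T, hT, hT0⟩ : ∃ T : (E i → ℚ) →ₗ[ℚ] W,
      (∀ (g : G) (f : E i → ℚ), T (fun x => f (g⁻¹ • x)) = σ g (T f)) ∧ T (antiVec (Φ i) (1 : G)) ≠ 0 := by
    by_contra hall
    push Not at hall
    refine hEv (Submodule.span_eq_bot.2 ?_)
    rintro v ⟨T, hT, rfl⟩
    exact hall T hT
  haveI := hσ
  let W' : Subrepresentation σ := ⟨(antiSpan G (Φ i)).map T, fun g w hw => by
    obtain ⟨b, hb, rfl⟩ := hw
    exact ⟨fun s => b (g⁻¹ • s), comp_smul_mem_antiSpan hb g⁻¹, hT g b⟩⟩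
  rcases hσ.eq_bot_or_eq_top W' with hW | hW
  · exfalso
    apply hT0
    have hmemW : T (antiVec (Φ i) (1 : G)) ∈ W'.toSubmodule := ⟨antiVec (Φ i) (1 : G), Submodule.subset_span ⟨1, rfl⟩, rfl⟩
    rw [hW] at hmemW
    exact (Submodule.mem_bot ℚ).1 hmemW
  · exact ⟨T, hT, hT0, congrArg Subrepresentation.toSubmodule hW⟩

/-- **PAIRWISE `ρ`-SEPARATED SLOTS ARE ADDITIVE.**  `G` permutes finite slots `E_i`, `Φ_i` are CM types for `ρ`, and for
all `i ≠ j` some `τ ∈ G` acts as `ρ` on `E_i` and trivially on `E_j`.  THEN every family on these slots is additive: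
`dim U(Σ) = Σ_i dim U(Φ_i)` — on Mumford–Tate groups `Hg(∏_i A_i) = ∏_i Hg(A_i)`, the `A_i` arbitrary (degenerate allowed).
(A minimal non-additive sub-family has `≥ 2` members `i ≠ j` and a common irreducible quotient `V` of `U(Φ_i)` and
`U(Φ_j)`; `τ` acts on `V` as `−1` through `U(Φ_i) ≤ Anti_ρ` and as `+1` through `U(Φ_j)`, so `V = 0`.)
[cite: Gordon1999HodgeAVSurvey, §3 Theorem (proof) and 7.7] [cite: MoonenZarhin1999LowDim, §3 (3.1)] [cite: Mai1989, §2 Prop. 1 (proof)] -/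
theorem finrank_antiSpan_sigmaType_eq_sum_of_pairwise_separated {ρ : G} {Φ : ∀ i, Set (E i)}
    (h : ∀ i, IsCMTypeWith ρ (Φ i))
    (hsep : ∀ i j : I, i ≠ j → ∃ τ : G, (∀ s : E i, τ • s = ρ • s) ∧ ∀ s : E j, τ • s = s) :
    Module.finrank ℚ (antiSpan G (sigmaType Φ)) = ∑ i, Module.finrank ℚ (antiSpan G (Φ i)) := by
  classical
  obtain ⟨n, S, π, K, -, hirr, hne, hcov⟩ := exists_covering_irreducibles_slots (G := G) (E := E)
  -- sub-family additivity and its finite criterion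
  have hFT : ∀ T : Finset I,
      (Module.finrank ℚ (antiSpan G (sigmaType fun j : (T : Set I) => Φ j)) =
          ∑ j : (T : Set I), Module.finrank ℚ (antiSpan G (Φ j)) ↔
        ∀ k : K, Module.finrank ℚ
            (⨆ j : (T : Set I), Ev[G, π k.1, antiVec (Φ j) (1 : G)] : Submodule ℚ (S k.1)) =
          ∑ j : (T : Set I), Module.finrank ℚ Ev[G, π k.1, antiVec (Φ j) (1 : G)]) := fun T =>
    finrank_antiSpan_sigmaType_eq_sum_iff_forall (E := fun j : (T : Set I) => E j) (V := fun k : K => S k.1)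
      (fun j => Φ j) (fun k => π k.1) (fun k => hirr k.1)
      (fun k l hkl T' => hne k.1 k.2 l.1 l.2 (fun h' => hkl (Subtype.ext h')) T')
      fun j P _ hP0 hPst => by
        obtain ⟨k, hk, T', hT', a, ha, ha0⟩ := hcov j P hP0 hPst
        exact ⟨⟨k, hk⟩, T', hT', a, ha, ha0⟩
  -- a non-additive sub-family exists (F8, degree form with `q = Σ_i dim U(Φ_i)`); take one of least cardinality
  by_contra hbad
  have hq : ∀ i, Module.finrank ℚ (antiSpan G (Φ i)) ≤ ∑ j, Module.finrank ℚ (antiSpan G (Φ j)) := fun i =>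
    Finset.single_le_sum (f := fun j => Module.finrank ℚ (antiSpan G (Φ j))) (fun j _ => Nat.zero_le _)
      (Finset.mem_univ i)
  have hex : ∃ m, ∃ T : Finset I, T.card = m ∧
      Module.finrank ℚ (antiSpan G (sigmaType fun j : (T : Set I) => Φ j)) ≠
        ∑ j : (T : Set I), Module.finrank ℚ (antiSpan G (Φ j)) := by
    by_contra hall
    push Not at hall
    exact hbad ((finrank_antiSpan_sigmaType_eq_sum_iff_forall_card_le_of_finrank_antiSpan_le Φ _ hq).2
      fun T _ => hall T.card T rfl)
  obtain ⟨T₀, hT₀card, hT₀⟩ := Nat.find_spec hex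
  have hmin : ∀ T : Finset I, T ⊂ T₀ →
      Module.finrank ℚ (antiSpan G (sigmaType fun j : (T : Set I) => Φ j)) =
        ∑ j : (T : Set I), Module.finrank ℚ (antiSpan G (Φ j)) := by
    intro T hT
    by_contra hTbad
    exact Nat.find_min hex (hT₀card ▸ Finset.card_lt_card hT) ⟨T, rfl, hTbad⟩
  -- the common irreducible quotient
  obtain ⟨k, hk⟩ := exists_forall_evalSpace_ne_bot_of_minimal_nonadditive (V := fun k : K => S k.1) Φ
    (fun k => π k.1) (fun k => hirr k.1) (fun k l hkl T' => hne k.1 k.2 l.1 l.2 (fun h' => hkl (Subtype.ext h')) T')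
    (fun j P _ hP0 hPst => by
      obtain ⟨k, hk, T', hT', a, ha, ha0⟩ := hcov j P hP0 hPst
      exact ⟨⟨k, hk⟩, T', hT', a, ha, ha0⟩) T₀ hT₀ hmin
  -- `T₀` has at least two members (the empty and one-member families are additive)
  obtain ⟨i, hi, j, hj, hij⟩ : ∃ i ∈ T₀, ∃ j ∈ T₀, i ≠ j := by
    by_contra hsmall
    push Not at hsmall
    apply hT₀
    refine (hFT T₀).2 fun k' => ?_
    -- all members of `T₀` coincide: the supremum and the sum have at most one (repeated) term
    rcases T₀.eq_empty_or_nonempty with hT₀e | ⟨i₀, hi₀⟩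
    · subst hT₀e
      haveI : IsEmpty ((∅ : Finset I) : Set I) := by simp
      rw [Fintype.sum_empty, iSup_of_empty, finrank_bot]
    · have hall : ∀ j : (T₀ : Set I), j = ⟨i₀, hi₀⟩ := fun j => Subtype.ext (hsmall j.1 j.2 i₀ hi₀)
      haveI : Unique (T₀ : Set I) := ⟨⟨⟨i₀, hi₀⟩⟩, hall⟩
      rw [Fintype.sum_unique, iSup_unique]
  obtain ⟨τ, hτi, hτj⟩ := hsep i j hij
  -- `V_k` is a quotient of `U(Φ_i)` (where `τ` acts as `ρ`, i.e. `−1`) and of `U(Φ_j)` (where `τ` acts trivially)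
  obtain ⟨Ti, hTi, hTi0, hTitop⟩ :=
    exists_equivariant_map_top_of_evalSpace_ne_bot Φ (π k.1) (hirr k.1) i (hk i hi)
  obtain ⟨Tj, hTj, -, hTjtop⟩ :=
    exists_equivariant_map_top_of_evalSpace_ne_bot Φ (π k.1) (hirr k.1) j (hk j hj)
  have hτinv_i : ∀ s : E i, τ⁻¹ • s = ρ • s := fun s => by
    have h1 : τ • ρ • s = s := by rw [hτi, (h i).invol]
    exact (eq_inv_smul_iff.2 h1).symm
  have hτinv_j : ∀ s : E j, τ⁻¹ • s = s := fun s => (eq_inv_smul_iff.2 (hτj s)).symm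
  -- `π_k(τ) = +1` on `V_k`
  have hplus : ∀ v : S k.1, π k.1 τ v = v := by
    intro v
    have hv : v ∈ (antiSpan G (Φ j)).map Tj := hTjtop ▸ Submodule.mem_top
    obtain ⟨f, -, rfl⟩ := hv
    rw [← hTj]
    congr 1
    funext s
    rw [hτinv_j]
  -- `π_k(τ) = −1` on `V_k`
  have hminus : ∀ v : S k.1, π k.1 τ v = -v := by
    intro v
    have hv : v ∈ (antiSpan G (Φ i)).map Ti := hTitop ▸ Submodule.mem_top
    obtain ⟨f, hf, rfl⟩ := hv
    rw [← hTi, ← map_neg]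
    congr 1
    funext s
    rw [hτinv_i]
    exact mem_antiWeights_iff'.1 (antiSpan_le_antiWeights' (h i) hf) s
  -- hence `V_k = 0`, contradicting `Ti(u_i) ≠ 0`
  apply hTi0
  have hv := hplus (Ti (antiVec (Φ i) (1 : G)))
  rw [hminus] at hv
  have h2 : (2 : ℚ) • Ti (antiVec (Φ i) (1 : G)) = 0 := by
    rw [two_smul]
    nth_rewrite 1 [← hv]
    rw [neg_add_cancel]
  exact (smul_eq_zero.1 h2).resolve_left (by norm_num)

omit [Fintype I] [∀ i, Fintype (E i)] in
/-- The tree's `SlotwiseIndependent` (every `g` realised on `E_i` by an element trivial on all other slots) implies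
pairwise `ρ`-separation; so `finrank_antiSpan_sigmaType_eq_sum_of_pairwise_separated` generalises
`finrank_antiSpan_sigmaType_eq` / `typeRank_sigmaType_add_card_eq`. [cite: Gordon1999HodgeAVSurvey, §3 Theorem (proof)] -/
theorem pairwise_separated_of_slotwiseIndependent (hind : SlotwiseIndependent G E) (ρ : G) :
    ∀ i j : I, i ≠ j → ∃ τ : G, (∀ s : E i, τ • s = ρ • s) ∧ ∀ s : E j, τ • s = s := by
  intro i j hij
  obtain ⟨τ, hτ, hτ'⟩ := hind i ρ
  exact ⟨τ, hτ, hτ' j (Ne.symm hij)⟩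

/-- **Rank form**: pairwise `ρ`-separated slots ⟹ `rank(Σ) + |I| = Σ_i rank(Φ_i) + 1` (`dim MT(∏ A_i) − 1 = Σ (dim MT(A_i) − 1)`).
[cite: Gordon1999HodgeAVSurvey, §3 Theorem and 7.7] [cite: MoonenZarhin1999LowDim, §3 (3.1)] -/
theorem typeRank_sigmaType_add_card_eq_of_pairwise_separated [Nonempty I] [∀ i, Nonempty (E i)] {ρ : G}
    {Φ : ∀ i, Set (E i)} (h : ∀ i, IsCMTypeWith ρ (Φ i))
    (hsep : ∀ i j : I, i ≠ j → ∃ τ : G, (∀ s : E i, τ • s = ρ • s) ∧ ∀ s : E j, τ • s = s) :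
    typeRank G (sigmaType Φ) + Fintype.card I = (∑ i, typeRank G (Φ i)) + 1 :=
  (typeRank_sigmaType_add_card_eq_iff_finrank_eq h).2 (finrank_antiSpan_sigmaType_eq_sum_of_pairwise_separated h hsep)

/-- **Pairwise `ρ`-separated slots: the family is nondegenerate iff every member is.**
[cite: Gordon1999HodgeAVSurvey, §3 Theorem (2) and 7.5] -/
theorem typeRank_sigmaType_eq_iff_forall_of_pairwise_separated [Nonempty I] [∀ i, Nonempty (E i)] {ρ : G}
    {Φ : ∀ i, Set (E i)} (h : ∀ i, IsCMTypeWith ρ (Φ i))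
    (hsep : ∀ i j : I, i ≠ j → ∃ τ : G, (∀ s : E i, τ • s = ρ • s) ∧ ∀ s : E j, τ • s = s) :
    typeRank G (sigmaType Φ) = Fintype.card (Σ i, E i) / 2 + 1 ↔
      ∀ i, typeRank G (Φ i) = Fintype.card (E i) / 2 + 1 := by
  have hsum := typeRank_sigmaType_add_card_eq_of_pairwise_separated h hsep
  have hle : ∀ i, typeRank G (Φ i) ≤ Fintype.card (E i) / 2 + 1 := fun i => (h i).typeRank_le
  have htot : ∑ j, (Fintype.card (E j) / 2 + 1) = (∑ j, Fintype.card (E j) / 2) + Fintype.card I := by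
    rw [Finset.sum_add_distrib, Finset.sum_const, Finset.card_univ, smul_eq_mul, mul_one]
  rw [card_sigma_div_two h]
  constructor
  · intro hS i
    by_contra hne
    have hlt : typeRank G (Φ i) < Fintype.card (E i) / 2 + 1 := lt_of_le_of_ne (hle i) hne
    have hsum_lt : ∑ j, typeRank G (Φ j) < ∑ j, (Fintype.card (E j) / 2 + 1) :=
      Finset.sum_lt_sum (fun j _ => hle j) ⟨i, Finset.mem_univ i, hlt⟩
    rw [htot] at hsum_lt
    omega
  · intro hall
    have hsum_eq : ∑ j, typeRank G (Φ j) = ∑ j, (Fintype.card (E j) / 2 + 1) := Finset.sum_congr rfl fun j _ => hall j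
    rw [htot] at hsum_eq
    omega

end IrrOdd

/-! ### §3 CM fields: conjugation on `K_i` realised by an automorphism of `ℂ` fixing `K_j` -/

open CategoryTheory CategoryTheory.Limits
open Literature.NumberTheory.ComplexMultiplication
open Literature.AlgebraicGeometry.Motives (AbelianVariety CMType)
open Literature.AlgebraicGeometry.HodgeTheory
open Literature.AlgebraicGeometry.ComplexMultiplication (IsCMTypeRealisation)
open Literature.AlgebraicGeometry.Pohlmann1968
open Literature.AlgebraicGeometry.VanGeemen1994 (hodgeClassSpan)
open Literature.Barriers.HodgeConjecture (divisorClassesSpan)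

variable {I : Type} [Fintype I] {K : I → Type} [∀ i, Field (K i)] [∀ i, NumberField (K i)] [∀ i, IsCMField (K i)]
  {L : Type} [Field L] [NumberField L] [Normal ℚ L]

/-- **`Hg(∏ A_i) = ∏ Hg(A_i)` FOR PAIRWISE CONJUGATION-SEPARATED CM FIELDS.**  CM fields `K_i` with ARBITRARY CM types `Φ_i`
(degenerate allowed).  If for all `i ≠ j` some automorphism `τ` of `ℂ` satisfies `τ ∘ s = s̄` for every embedding
`s : K_i → ℂ` and `τ ∘ s = s` for every embedding `s : K_j → ℂ` (i.e. `τ` is complex conjugation on the Galois closure of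
`K_i` and the identity on that of `K_j`; such `τ` exists iff the two Galois closures intersect in a totally real field),
then `cmFamilyRank Φ + |I| = Σ_i cmTypeRank Φ_i + 1`: `dim MT(∏ A_i) − 1 = Σ_i (dim MT(A_i) − 1)`, `Hg(∏_i A_i) = ∏_i Hg(A_i)`.
[cite: Gordon1999HodgeAVSurvey, §3 Theorem and 7.7] [cite: MoonenZarhin1999LowDim, §3 (3.1)] [cite: Shimura1998, §18.2] -/
theorem cmFamilyRank_add_card_eq_of_pairwise_separated [Nonempty I] (Φ : ∀ i, CMType (K i))
    (hsep : ∀ i j : I, i ≠ j → ∃ τ : ℂ ≃+* ℂ,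
      (∀ s : K i →+* ℂ, τ • s = (starRingAut : ℂ ≃+* ℂ) • s) ∧ ∀ s : K j →+* ℂ, τ • s = s) :
    CMAlgebra.cmFamilyRank Φ + Fintype.card I = (∑ i, cmTypeRank (Φ i)) + 1 := by
  haveI : ∀ i, Nonempty (K i →+* ℂ) := fun i => inferInstance
  exact (cmFamilyRank_add_card_eq_iff_finrank_eq_univ Φ).2
    (IrrOdd.finrank_antiSpan_sigmaType_eq_sum_of_pairwise_separated (E := fun i => K i →+* ℂ)
      (fun i => isCMTypeWith_conj (Φ i)) hsep)

/-- **… and then the family is nondegenerate iff every member is**: for pairwise conjugation-separated CM fields,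
`IsNondegenerateFamily Φ ↔ ∀ i, IsNondegenerate (Φ i)` — products of nondegenerate CM abelian varieties with pairwise
conjugation-separated CM fields carry only the expected Hodge classes (`B• = D•` on all products, tree).
[cite: Gordon1999HodgeAVSurvey, §3 Theorem (2) and 7.5] -/
theorem isNondegenerateFamily_iff_forall_of_pairwise_separated [Nonempty I] (Φ : ∀ i, CMType (K i))
    (hsep : ∀ i j : I, i ≠ j → ∃ τ : ℂ ≃+* ℂ,
      (∀ s : K i →+* ℂ, τ • s = (starRingAut : ℂ ≃+* ℂ) • s) ∧ ∀ s : K j →+* ℂ, τ • s = s) :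
    CMAlgebra.IsNondegenerateFamily Φ ↔ ∀ i, IsNondegenerate (Φ i) := by
  classical
  haveI : ∀ i, Nonempty (K i →+* ℂ) := fun i => inferInstance
  have hmain := IrrOdd.typeRank_sigmaType_eq_iff_forall_of_pairwise_separated (E := fun i => K i →+* ℂ)
    (fun i => isCMTypeWith_conj (Φ i)) hsep
  have hcardI : Fintype.card (Σ i, (K i →+* ℂ)) = ∑ i, Module.finrank ℚ (K i) := by
    rw [Fintype.card_sigma]
    exact Finset.sum_congr rfl fun i _ => Embeddings.card (K i) ℂ
  rw [CMAlgebra.isNondegenerateFamily_iff, ← hcardI]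
  change typeRank (ℂ ≃+* ℂ) (sigmaType fun i => (Φ i).1) = _ ↔ _
  rw [hmain]
  refine forall_congr' fun i => ?_
  rw [isNondegenerate_iff, ← Embeddings.card (K i) ℂ]
  rfl

/-- **Galois form over a common Galois field `L`** (`e_i : K_i → L`, `ι : L → ℂ`, `ρ_L` complex conjugation of `L`): if for
all `i ≠ j` some `g ∈ Gal(L/ℚ)` acts as `ρ_L` on every conjugate of `e_i(K_i)` and as the identity on every conjugate of
`e_j(K_j)`, then `Hg(∏_i A_i) = ∏_i Hg(A_i)` for arbitrary CM types. [cite: Shimura1998, §8.1 and §18.2]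
[cite: Gordon1999HodgeAVSurvey, §3 Theorem and 7.7] -/
theorem cmFamilyRank_add_card_eq_of_pairwise_separated_gal [Nonempty I] (ι : L →+* ℂ) (e : ∀ i, K i →+* L)
    (ρ : L ≃ₐ[ℚ] L) (hρ : ∀ x, ι (ρ x) = starRingEnd ℂ (ι x)) (Φ : ∀ i, CMType (K i))
    (hsep : ∀ i j : I, i ≠ j → ∃ g : L ≃ₐ[ℚ] L,
      (∀ (h : L ≃ₐ[ℚ] L) (x : K i), g (h (e i x)) = ρ (h (e i x))) ∧
        ∀ (h : L ≃ₐ[ℚ] L) (y : K j), g (h (e j y)) = h (e j y)) :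
    CMAlgebra.cmFamilyRank Φ + Fintype.card I = (∑ i, cmTypeRank (Φ i)) + 1 := by
  obtain ⟨r, hr, hsurj⟩ := exists_restrictHom ι
  refine cmFamilyRank_add_card_eq_of_pairwise_separated Φ fun i j hij => ?_
  obtain ⟨g, hgi, hgj⟩ := hsep i j hij
  obtain ⟨τ, rfl⟩ := hsurj g
  refine ⟨τ, fun s => ?_, fun s => ?_⟩
  · obtain ⟨h, rfl⟩ := exists_eq_comp_algEquiv_comp ι e i s
    refine RingHom.ext fun x => ?_
    change τ (ι (h (e i x))) = starRingEnd ℂ (ι (h (e i x)))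
    rw [hr, hgi, hρ]
  · obtain ⟨h, rfl⟩ := exists_eq_comp_algEquiv_comp ι e j s
    refine RingHom.ext fun y => ?_
    change τ (ι (h (e j y))) = ι (h (e j y))
    rw [hr, hgj]

variable {A : I → AbelianVariety ℂ} {ιA : ∀ i, 𝓞 (K i) →+* End (A i)}
  {θ : ∀ i, K i →+* Module.End ℂ (complexBetti (A i).X 1)}

/-- **HC ON ALL PRODUCTS OF NONDEGENERATE CM ABELIAN VARIETIES WITH PAIRWISE CONJUGATION-SEPARATED CM FIELDS**: if every
`Φ_i` is nondegenerate and for all `i ≠ j` some automorphism of `ℂ` is complex conjugation on the embeddings of `K_i` and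
the identity on those of `K_j`, then on every product `⨁_{j<N} A_{c j}` of realisations the Hodge conjecture holds with
`B• = D•` (Imai's theorem for pairwise non-isogenous CM elliptic curves, run for arbitrary nondegenerate CM factors).
[cite: Gordon1999HodgeAVSurvey, §3 Theorem and 7.5] [cite: MoonenZarhin1999LowDim, §3 (3.1)] -/
theorem hodgeConjectureFor_prod_of_pairwise_separated [Nonempty I] (Φ : ∀ i, CMType (K i))
    (hsep : ∀ i j : I, i ≠ j → ∃ τ : ℂ ≃+* ℂ,
      (∀ s : K i →+* ℂ, τ • s = (starRingAut : ℂ ≃+* ℂ) • s) ∧ ∀ s : K j →+* ℂ, τ • s = s)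
    (hnd : ∀ i, IsNondegenerate (Φ i)) (hA : ∀ i, IsCMTypeRealisation (Φ i) (A i) (ιA i) (θ i)) {N : ℕ}
    (c : Fin N → I) :
    HodgeConjectureFor (⨁ fun j : Fin N => A (c j)).dim (⨁ fun j : Fin N => A (c j)).X ∧
      ∀ m : ℕ, hodgeClassSpan (⨁ fun j : Fin N => A (c j)).dim (⨁ fun j : Fin N => A (c j)).X m =
        divisorClassesSpan (⨁ fun j : Fin N => A (c j)).X (⨁ fun j : Fin N => A (c j)).dim m := by
  have hfam : CMAlgebra.IsNondegenerateFamily Φ := (isNondegenerateFamily_iff_forall_of_pairwise_separated Φ hsep).2 hnd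
  exact ⟨hfam.hodgeConjectureFor_prod hA c, fun m => hfam.hodgeClassSpan_prod_eq_divisorClassesSpan hA c m⟩

end Summit.HodgeConjecture.CorCM

end
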